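import Summits.ResolutionOfSingularities.ResolutionOfSingularities.Theorems.EquisingularLiftEquisingularLiftNatCentreRegularImmersion
import HarnessLib

/-!
# [OURS · L1 W4.5(b) · LINE (T-j)-PROOF · BRICK B4, sub-brick (B4-a2)] A regular CODIMENSION-ONE centre is a regular immersion of
# codimension one (the `c = 1` twin of res-D-brk-4's `isRegularImmersionOfCodim_two_of_twoFrames`, p566652)

Crux chain w45b (cell `res-hironaka`), EL♮(3) stmt-ResolutionOfSingularities-20148, LINE (T-j)-PROOF of F-102 (res-L1-w45b-lead-2 g3, skeleton v3
1683bb741349c142), BRICK B4 `exists_coordinate_functions` step (B4-a) (res-L1-type-o6 g30). OURS; NOT a statement of any manuscript; AI-written,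
weaker than expert review. No `sorry`; standard axioms; DEF-FREE. `--supports stmt-ResolutionOfSingularities-20148 --as helper`.

`isRegularImmersionOfCodim_one_of_codim_one`: for `X` integral, locally Noetherian and regular, and an ideal sheaf `𝒞` with `V(𝒞)` regular and
`dim (𝒪_{X,x} ⧸ 𝒞_x) + 1 = dim 𝒪_{X,x}` on `supp 𝒞`: `IsRegularImmersionOfCodim 𝒞.subschemeι 1` — near every point an affine open `U = D(g)` and ONE
non-zero-divisor `f₀ ∈ Γ(X, U)` generating `𝒞(U)`.  PROOF = res-D-brk-4's spreading-out argument VERBATIM with `2 ↦ 1` (one generator with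
independent differential at the regular stalk by `exists_span_eq_of_isRegularLocalRing_quotient` + the dimension count; uniform denominators;
`Γ(X, D(g)) = A[1/g]`).  With `…F102IdealLineBundle` (p576456, (B4-a1)) this makes the ideal module of such a centre — in particular of a SECTION
`D = s(Spec O)` of the regular `O`-curve `C` of F-102 — a LINE BUNDLE.
References: [cite: Liu2002, Thm. 8.1.19 (a)] [cite: Matsumura1987, Thm. 14.2, Thm. 16.2] [cite: GortzWedhorn2023, Def. 19.19] (index only).
-/

set_option linter.dupNamespace false -- mandated namespace `Summit.<Summit>.<Problem>` of this single-conjunct summit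

noncomputable section

open CategoryTheory AlgebraicGeometry IsLocalRing TopologicalSpace
open Literature.AlgebraicGeometry.Resolution
open Literature.AlgebraicGeometry.HodgeTheory
open AlgebraicGeometry.Scheme.IdealSheafData
open RingTheory.Sequence
open scoped Pointwise

namespace Summit.ResolutionOfSingularities.ResolutionOfSingularities.Cruxes.EquisingularLiftNat.F102

open Summit.ResolutionOfSingularities.ResolutionOfSingularities.Cruxes.EquisingularLiftNat.Sections

universe u

/-- **(B4-a2) A regular codimension-`1` centre is a regular immersion of codimension `1`** (`c = 1` twin of res-D-brk-4's
`Sections.isRegularImmersionOfCodim_two_of_twoFrames`, p566652; same proof with one generator).  For `X` integral, locally Noetherian and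
regular, and an ideal sheaf `𝒞` with `V(𝒞)` regular and `dim (𝒪_{X,x} ⧸ 𝒞_x) + 1 = dim 𝒪_{X,x}` on `supp 𝒞`:
`IsRegularImmersionOfCodim 𝒞.subschemeι 1`. [OURS · L1 W4.5b · (T-j)-PROOF B4] [cite: Liu2002, Thm. 8.1.19 (a)] [cite: Matsumura1987, Thm. 14.2];
NOT a statement of the manuscript. -/
theorem isRegularImmersionOfCodim_one_of_codim_one {X : Scheme.{u}} [IsIntegral X] [IsLocallyNoetherian X]
    (𝒞 : X.IdealSheafData) (hX : Scheme.IsRegular X) (h𝒞 : Scheme.IsRegular 𝒞.subscheme)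
    (hcodim : ∀ x ∈ 𝒞.support, ringKrullDim (X.presheaf.stalk x ⧸ stalkIdeal 𝒞 x) + 1 = ringKrullDim (X.presheaf.stalk x)) :
    IsRegularImmersionOfCodim 𝒞.subschemeι 1 := by
  classical
  refine ⟨inferInstance, fun z => ?_⟩
  -- the point `x = ι z ∈ supp 𝒞`, an affine open `V ∋ x`, `A = Γ(X, V)`, the prime `𝔭` of `x`, `I = 𝒞(V)`
  set x : X := 𝒞.subschemeι.base z with hxdef
  have hxsupp : x ∈ 𝒞.support := by
    have h : x ∈ (𝒞.support : Set X) := by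
      rw [← Scheme.IdealSheafData.range_subschemeι]; exact ⟨z, rfl⟩
    exact h
  obtain ⟨V', hV', hxV, -⟩ :=
    exists_isAffineOpen_mem_and_subset (X := X) (x := x) (U := ⊤) (Opens.mem_top x)
  let V : X.affineOpens := ⟨V', hV'⟩
  have hV : IsAffineOpen (V : X.Opens) := hV'
  haveI : IsNoetherianRing Γ(X, V) := IsLocallyNoetherian.component_noetherian V
  letI algR : Algebra Γ(X, V) (X.presheaf.stalk x) := TopCat.Presheaf.algebra_section_stalk X.presheaf ⟨x, hxV⟩
  set 𝔭 : Ideal Γ(X, V) := (hV.primeIdealOf ⟨x, hxV⟩).asIdeal with h𝔭def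
  haveI h𝔭p : 𝔭.IsPrime := (hV.primeIdealOf ⟨x, hxV⟩).isPrime
  haveI hloc : IsLocalization.AtPrime (X.presheaf.stalk x) 𝔭 := hV.isLocalization_stalk ⟨x, hxV⟩
  set I : Ideal Γ(X, V) := 𝒞.ideal V with hIdef
  -- the regular local ring `R = 𝒪_{X,x}` and `J = 𝒞_x = I R` with regular quotient
  haveI : IsRegularLocalRing (X.presheaf.stalk x) := hX x
  have hJ : stalkIdeal 𝒞 x = I.map (algebraMap Γ(X, V) (X.presheaf.stalk x)) := by
    rw [stalkIdeal_eq_map_germ 𝒞 V hxV]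
    rfl
  have hJm : stalkIdeal 𝒞 x ≤ maximalIdeal _ := (mem_support_iff_stalkIdeal_le 𝒞 x).mp hxsupp
  have hsurj : Function.Surjective (𝒞.subschemeι.stalkMap z).hom := 𝒞.subschemeι.stalkMap_surjective z
  have hker : RingHom.ker (𝒞.subschemeι.stalkMap z).hom = stalkIdeal 𝒞 x := by
    rw [← stalkIdeal_ker_eq_ker_stalkMap, Scheme.IdealSheafData.ker_subschemeι]
  haveI := h𝒞 z
  haveI hq : IsRegularLocalRing (X.presheaf.stalk x ⧸ stalkIdeal 𝒞 x) :=
    IsRegularLocalRing.of_ringEquiv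
      (((RingHom.quotientKerEquivOfSurjective hsurj).symm).trans (Ideal.quotEquivOfEq hker))
  -- (1) generators `f′ᵢ = fᵢ/1`, `fᵢ ∈ I`, with independent differentials; exactly two of them
  have hG : Ideal.span (algebraMap Γ(X, V) (X.presheaf.stalk x) '' (I : Set Γ(X, V))) = stalkIdeal 𝒞 x := by
    rw [hJ]; rfl
  obtain ⟨c, f', hf'G, hspan', hli⟩ := exists_span_eq_of_isRegularLocalRing_quotient hJm _ hG
  have hf'𝔪 : ∀ i, f' i ∈ maximalIdeal _ := fun i => hJm (hspan' ▸ Ideal.subset_span ⟨i, rfl⟩)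
  have hc : c = 1 := by
    have hdim := (RegularParameters.isRegularLocalRing_quotient_span_range f' hf'𝔪
      (forall_mem_maximalIdeal_of_linearIndependent_toCotangent f' hf'𝔪 hli)).2
    rw [hspan'] at hdim
    obtain ⟨d, hd⟩ := exists_ringKrullDim_eq_natCast (X.presheaf.stalk x ⧸ stalkIdeal 𝒞 x)
    have h := hdim.trans (hcodim x hxsupp).symm
    rw [hd] at h
    have h' : ((d + c : ℕ) : WithBot ℕ∞) = ((d + 1 : ℕ) : WithBot ℕ∞) := by push_cast; exact h
    have h'' : d + c = d + 1 := by exact_mod_cast h'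
    omega
  subst hc
  -- preimages `fᵢ ∈ I`
  have hpre : ∀ i, ∃ a : Γ(X, V), a ∈ I ∧ algebraMap Γ(X, V) (X.presheaf.stalk x) a = f' i := fun i => by
    obtain ⟨a, ha, h⟩ := hf'G i
    exact ⟨a, ha, h⟩
  choose f hfI hff' using hpre
  have himg : ∀ T : Set (Fin 1), Ideal.span (f' '' T) =
      (Ideal.span (f '' T)).map (algebraMap Γ(X, V) (X.presheaf.stalk x)) := fun T => by
    rw [Ideal.map_span, Set.image_image]
    congr 1
    ext w
    simp only [Set.mem_image, hff']
  -- colon-form regularity at `𝔭`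
  have hreg : ∀ (i : Fin 1) (y : Γ(X, V)), f i * y ∈ Ideal.span (f '' Set.Iio i) →
      ∃ s : Γ(X, V), s ∉ 𝔭 ∧ s * y ∈ Ideal.span (f '' Set.Iio i) := by
    intro i y hy
    have h1 : f' i * algebraMap Γ(X, V) (X.presheaf.stalk x) y ∈ Ideal.span (f' '' Set.Iio i) := by
      rw [himg, ← hff', ← map_mul]
      exact Ideal.mem_map_of_mem _ hy
    have h2 := mem_span_image_of_mul_mem_of_linearIndependent_toCotangent f' hf'𝔪 hli i (Set.Iio i)
      (fun h => lt_irrefl i h) _ h1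
    rw [himg, IsLocalization.algebraMap_mem_map_algebraMap_iff 𝔭.primeCompl] at h2
    obtain ⟨s, hs, hsy⟩ := h2
    exact ⟨s, hs, hsy⟩
  obtain ⟨g₁, hg₁p, hg₁⟩ := exists_uniform_multiplier_of_regular_at_prime f 𝔭 hreg
  -- (2) the generators of `I` lie in `(f) A_𝔭`: clear denominators
  obtain ⟨gens, hgens⟩ := (IsNoetherian.noetherian I : I.FG)
  have hgen1 : ∀ w : Γ(X, V), w ∈ gens → ∃ t : Γ(X, V), t ∉ 𝔭 ∧ t * w ∈ Ideal.span (Set.range f) := by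
    intro w hw
    have hwI : w ∈ I := hgens ▸ Submodule.subset_span hw
    have h1 : algebraMap Γ(X, V) (X.presheaf.stalk x) w ∈ Ideal.span (Set.range f') := by
      rw [hspan', hJ]
      exact Ideal.mem_map_of_mem _ hwI
    have hrange : Set.range f' = Set.range (algebraMap Γ(X, V) (X.presheaf.stalk x) ∘ f) := by
      ext w'
      simp only [Set.mem_range, Function.comp_apply, hff']
    rw [hrange, Set.range_comp, ← Ideal.map_span,
      IsLocalization.algebraMap_mem_map_algebraMap_iff 𝔭.primeCompl] at h1
    obtain ⟨t, ht, htw⟩ := h1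
    exact ⟨t, ht, htw⟩
  choose! t ht using hgen1
  have hg₀p : (∏ w ∈ gens, t w) ∉ 𝔭 := by
    intro hmem
    obtain ⟨w, hw, htw⟩ := (h𝔭p.prod_mem_iff).mp hmem
    exact (ht w hw).1 htw
  set g : Γ(X, V) := (∏ w ∈ gens, t w) * g₁ with hgdef
  have hgp : g ∉ 𝔭 := fun h => (h𝔭p.mem_or_mem h).elim hg₀p hg₁p
  -- (3) the affine open `U = D(g) ∋ x`, `Γ(X, U) = A[1/g]`
  let U : X.affineOpens := X.affineBasicOpen g
  have hxU : x ∈ (U : X.Opens) := by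
    show x ∈ X.basicOpen g
    rw [X.mem_basicOpen g x hxV]
    exact (IsLocalization.AtPrime.isUnit_to_map_iff (X.presheaf.stalk x) 𝔭 g).mpr hgp
  haveI hLoc : IsLocalization.Away g Γ(X, X.basicOpen g) := hV.isLocalization_basicOpen g
  have hunit : ∀ w : Γ(X, V), w ∈ gens → IsUnit (algebraMap Γ(X, V) Γ(X, X.basicOpen g) (t w)) := by
    intro w hw
    have hu : IsUnit (algebraMap Γ(X, V) Γ(X, X.basicOpen g) g) := IsLocalization.Away.algebraMap_isUnit g
    have hdvd : t w ∣ g := (Finset.dvd_prod_of_mem t hw).mul_right g₁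
    exact isUnit_of_dvd_unit (map_dvd (algebraMap Γ(X, V) Γ(X, X.basicOpen g)) hdvd) hu
  -- `I · Γ(X, U) = (f₀, f₁)`
  have hIL : I.map (algebraMap Γ(X, V) Γ(X, X.basicOpen g)) =
      Ideal.span (Set.range (algebraMap Γ(X, V) Γ(X, X.basicOpen g) ∘ f)) := by
    apply le_antisymm
    · rw [← hgens, Ideal.map_span, Ideal.span_le]
      rintro _ ⟨w, hw, rfl⟩
      have hw' : w ∈ gens := hw
      have hmem : algebraMap Γ(X, V) Γ(X, X.basicOpen g) (t w * w) ∈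
          Ideal.span (Set.range (algebraMap Γ(X, V) Γ(X, X.basicOpen g) ∘ f)) := by
        rw [Set.range_comp, ← Ideal.map_span]
        exact Ideal.mem_map_of_mem _ (ht w hw').2
      rw [map_mul] at hmem
      exact (Ideal.unit_mul_mem_iff_mem _ (hunit w hw')).mp hmem
    · rw [Ideal.span_le]
      rintro _ ⟨i, rfl⟩
      exact Ideal.mem_map_of_mem _ (hfI i)
  -- colon form on `Γ(X, U)`
  have hgmul : ∀ (i : Fin 1) (y : Γ(X, V)), f i * y ∈ Ideal.span (f '' Set.Iio i) →
      g * y ∈ Ideal.span (f '' Set.Iio i) := fun i y hy => by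
    rw [hgdef, mul_assoc]
    exact Ideal.mul_mem_left _ _ (hg₁ i y hy)
  set F₀ : Γ(X, X.basicOpen g) := algebraMap Γ(X, V) Γ(X, X.basicOpen g) (f 0) with hF₀
  have hIio0 : (algebraMap Γ(X, V) Γ(X, X.basicOpen g) ∘ f) '' Set.Iio (0 : Fin 1) = ∅ := by
    rw [Set.image_eq_empty]
    ext j
    simp only [Set.mem_Iio, Set.mem_empty_iff_false, iff_false]
    exact fun hj => (Nat.not_lt_zero _) (Fin.lt_def.mp hj)
  have h₀ : ∀ y : Γ(X, X.basicOpen g), F₀ * y = 0 → y = 0 := by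
    intro y hy
    have h := regularSeq_map_of_uniform_multiplier f hgmul Γ(X, X.basicOpen g) 0 y (by
      rw [hIio0, Ideal.span_empty]
      change F₀ * y ∈ (⊥ : Ideal Γ(X, X.basicOpen g))
      rw [hy]
      exact Submodule.zero_mem _)
    rwa [hIio0, Ideal.span_empty, Ideal.mem_bot] at h
  have hwr : IsWeaklyRegular Γ(X, X.basicOpen g) [F₀] := by
    rw [isWeaklyRegular_cons_iff]
    refine ⟨?_, IsWeaklyRegular.nil _ _⟩
    intro a b hab
    have h : F₀ * a = F₀ * b := hab
    have : a - b = 0 := h₀ _ (by rw [mul_sub, h, sub_self])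
    exact sub_eq_zero.mp this
  refine ⟨U, hxU, [F₀], rfl, hwr, ?_⟩
  -- `(F₀) = 𝓘(U)`
  have hker' : 𝒞.subschemeι.ker.ideal U = I.map (algebraMap Γ(X, V) Γ(X, X.basicOpen g)) := by
    rw [Scheme.IdealSheafData.ker_subschemeι]
    exact (𝒞.map_ideal_basicOpen V g).symm
  rw [hker', hIL]
  unfold Ideal.ofList
  congr 1
  ext w
  simp only [Set.mem_setOf_eq, List.mem_cons, List.not_mem_nil, or_false]
  constructor
  · rintro rfl
    exact ⟨0, rfl⟩
  · rintro ⟨j, rfl⟩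
    fin_cases j
    rfl

end Summit.ResolutionOfSingularities.ResolutionOfSingularities.Cruxes.EquisingularLiftNat.F102

end
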